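import Literature.Analysis.FluidPDE.RadialQuotientDerivatives
import Literature.Analysis.FluidPDE.AxisymHouLiVariables
import Literature.Analysis.FluidPDE.AxisymmetricNoSwirlWeightedEnstrophyProofs
import Literature.Analysis.FluidPDE.CheskidovShvydkoyAssembly
import HarnessLib

/-!
# The Hou–Li variables as weight-free ray averages; Sobolev and sup bounds

Analysis/FluidPDE support file (all results proved; no definitions, no named facts) on the
decomposition path of the named fact
`Literature.Analysis.FluidPDE.LeiZhang2017_smallSwirl_regularity` (Lei–Zhang 2017, Thm. 1.4).

The smooth Hou–Li variables of an axisymmetric field `u` (`AxisymHouLiVariables.lean`) are the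
radial quotients `u₁ = u^θ/r = radQuot Γ` (`angVelQuot`), `ω₁ = ω^θ/r = radQuot (swirl (curl u))`
(`angVortQuot`, Lei–Zhang's `Ω`) and `ρ = u^r/r = radQuot (x₀u₀ + x₁u₁)` (`radVelQuot`), where
`radQuot S x = ∫₀¹ s · (radDerivQuot S)(scaleH s x) ds` and `radDerivQuot S = (∂ᵣS)/r`.  The
numerators `Γ = x₀u₁ − x₁u₀`, `x₀u₀ + x₁u₁` carry the weight `x_h`, but their radial derivative
quotients do not: by the infinitesimal axisymmetry `Du(x)[Jx] = J u(x)`,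

* `IsAxisymmetric.radDerivQuot_swirl_eq` — **`(∂ᵣΓ)/r = ω_z = ∂₀u₁ − ∂₁u₀`** (`= (curl u)₂`;
  the classical `ω_z = (1/r)∂ᵣ(r u^θ)`), everywhere on `ℝ³`;
* `IsAxisymmetric.radDerivQuot_horizontal_inner_eq` — **`(∂ᵣ(r uʳ))/r = ∂₀u₀ + ∂₁u₁`**
  (`= −∂₂u₂` for divergence-free `u`), via `x₀u₀ + x₁u₁ = swirl (J ∘ u)`.

Hence `u₁(x) = ∫₀¹ s ω_z(s x_h, z) ds`, `ρ(x) = ∫₀¹ s (∂₀u₀ + ∂₁u₁)(s x_h, z) ds`,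
`ω₁(x) = ∫₀¹ s (curl curl u)_z (s x_h, z) ds` are horizontal ray averages of first and second
derivatives of `u` **without weights**, and the ray-average bounds of `RadialQuotientSobolev` /
`RadialQuotientDerivatives` give, for every order `n`,

* `lintegral_sq_iteratedFDeriv_radQuot_le_radDerivQuot` — `∫ ‖Dⁿ(radQuot S)‖² ≤ ∫ ‖Dⁿ(radDerivQuot S)‖²`
  and `norm_iteratedFDeriv_radQuot_le_half` — `‖Dⁿ(radQuot S)‖ ≤ B/2` if `‖Dⁿ(radDerivQuot S)‖ ≤ B`;
* `IsAxisymmetric.lintegral_sq_iteratedFDeriv_angVelQuot_le` — `∫‖Dⁿu₁‖² ≤ ‖curlCLM‖² ∫‖Dⁿ⁺¹u‖²`,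
  `…_radVelQuot_le` — `∫‖Dⁿρ‖² ≤ ‖curlCLM‖² ∫‖Dⁿ⁺¹u‖²`,
  `…_angVortQuot_le` — `∫‖Dⁿω₁‖² ≤ ‖curlCLM‖⁴ ∫‖Dⁿ⁺²u‖²`, with the matching sup bounds;
* family forms for time-dependent fields with bounded `L²` Sobolev norms
  (`HasBoundedSobolevNormsOn`, Tao's class): the three quotient families have bounded `L²`
  Sobolev norms of every order (`exists_lintegral_sq_iteratedFDeriv_angVelQuot_le`, …) and all
  their derivatives are bounded on the slab (`exists_forall_norm_iteratedFDeriv_le_of_sobolev`,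
  Sobolev imbedding `H² ⊂ C_B` applied to `Dⁿ`).

This is the integrability layer for the energy estimates of Lei–Zhang 2017, §4 (proof of
Thm. 1.4) in the smooth variables `(u₁, ω₁, ρ)`: no cut-offs at the axis are needed.

## Mathlib / tree search

Tree: `IsAxisymmetric.fderiv_swirl_horizontal` (`DΓ(x)[x_h] = r²(∂₀u₁ − ∂₁u₀)`,
`SwirlTransportProofs`), `fderiv_apply_horizontal_eq` (`DS(x)[x_h] = r² radDerivQuot S`,
`AxisymRadialQuotient`), `eq_of_eq_off_ker` (`AxisymmetricLiftR5`), `curl_apply_two`, `rotGen_rotZ`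
(`AxisymNoSwirlVorticity`), `norm_iteratedFDeriv_curl_le` (`KNSSThm52Integrand`),
`exists_forall_norm_le_of_sobolev_bounds` (`AxisymmetricNoSwirlWeightedEnstrophyProofs`),
`norm_iteratedFDeriv_iteratedFDeriv` (`CheskidovShvydkoyAssembly`),
`lintegral_sq_rayAverageH_le` (`RadialQuotientSobolev`), `norm_iteratedFDeriv_radQuot_le`,
`enorm_iteratedFDeriv_radQuot_le` (`RadialQuotientDerivatives`).  Mathlib:
`ContinuousLinearMap.norm_iteratedFDeriv_comp_left`, `norm_iteratedFDeriv_fderiv`,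
`LinearIsometryEquiv.norm_iteratedFDeriv_comp_left`.  No statement of `ω_z = (1/r)∂ᵣΓ` as an
identity of smooth functions on `ℝ³` in the tree (`lean search 'radDerivQuot_swirl|curl_apply_two_eq'`:
only the swirl-free case `curl_apply_two_eq_zero`).

## References

* Z. Lei, Q. S. Zhang, Pacific J. Math. 289 (2017) = arXiv:1505.02628, §4. [LeiZhang2017]
* J.-G. Liu, W.-C. Wang, SIAM J. Math. Anal. 41 (2009), §2 (`u^θ/r`, `ω^θ/r` are smooth; the
  identities `ω_z = (1/r)∂ᵣ(ru^θ)`, `∂ᵣ(ruʳ)/r = −∂_z u^z`). [folklore]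
* A. J. Majda, A. L. Bertozzi, *Vorticity and Incompressible Flow* (2002), §2.3.3. [folklore]
-/

noncomputable section

open MeasureTheory Set Function Filter Topology InnerProductSpace WithLp
open scoped ENNReal NNReal ContDiff

namespace Literature.Analysis.FluidPDE

/-! ### `(∂ᵣΓ)/r = ω_z` and `(∂ᵣ(ruʳ))/r = ∂₀u₀ + ∂₁u₁` -/

section Identities

variable {u : EuclideanSpace ℝ (Fin 3) → EuclideanSpace ℝ (Fin 3)}

/-- Off the plane `{x₀ = 0}` the cylindrical radius does not vanish. [folklore] -/
theorem cylRadius_ne_zero_of_apply_zero_ne_zero {x : EuclideanSpace ℝ (Fin 3)} (hx : x 0 ≠ 0) :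
    cylRadius x ≠ 0 := fun h => hx ((cylRadius_eq_zero_iff x).1 h).1

/-- **`(∂ᵣΓ)/r = ω_z`**: for an axisymmetric `u ∈ C²` the radial derivative quotient of the swirl
`Γ = x₀u₁ − x₁u₀` is the axial vorticity, `radDerivQuot Γ = ∂₀u₁ − ∂₁u₀ = (curl u)₂`, everywhere
(off the axis: `r² radDerivQuot Γ = DΓ(x)[x_h] = r²(∂₀u₁ − ∂₁u₀)` by the infinitesimal
axisymmetry; on the axis by continuity).  Classically `ω_z = (1/r)∂ᵣ(r u^θ)`. [folklore] -/
theorem IsAxisymmetric.radDerivQuot_swirl_eq (hax : IsAxisymmetric u) (hu : ContDiff ℝ 2 u) :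
    radDerivQuot (swirl u) = fun y => FluidPDE.curl u y 2 := by
  have hS : ContDiff ℝ 2 (swirl u) := contDiff_swirl hu
  have hd : Differentiable ℝ u := hu.differentiable (by norm_num)
  have hc1 : ContDiff ℝ 1 u := hu.of_le (by norm_num)
  funext y
  refine eq_of_eq_off_ker (EuclideanSpace.proj (0 : Fin 3))
    ⟨EuclideanSpace.single 0 1, by simp⟩ (continuous_radDerivQuot hS)
    ((contDiff_piLp_apply (𝕜 := ℝ) (p := 2) (n := 0) (i := (2 : Fin 3))).continuous.comp
      (continuous_curl (by exact_mod_cast hc1))) (fun z hz => ?_) y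
  have hz0 : z 0 ≠ 0 := by simpa using hz
  have hr : cylRadius z ^ 2 ≠ 0 := pow_ne_zero 2 (cylRadius_ne_zero_of_apply_zero_ne_zero hz0)
  have h1 := fderiv_apply_horizontal_eq hS hax.isAxisymmetricScalar_swirl z
  rw [← toLp_horizontal_eq_add_single, hax.fderiv_swirl_horizontal (hd z)] at h1
  simp only [Function.comp_apply, curl_apply_two]
  exact (mul_left_cancel₀ hr h1).symm

/-- `J ∘ u` is axisymmetric for axisymmetric `u` (`J` commutes with the rotations `R_θ`). [folklore] -/
theorem IsAxisymmetric.rotGen_comp (hax : IsAxisymmetric u) :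
    IsAxisymmetric fun x => rotGen (u x) := fun θ x => by
  simp only
  rw [hax θ x, rotGen_rotZ]

/-- `swirl (J ∘ u) = x₀u₀ + x₁u₁` (`= r uʳ`). [folklore] -/
theorem swirl_rotGen_comp (u : EuclideanSpace ℝ (Fin 3) → EuclideanSpace ℝ (Fin 3)) :
    swirl (fun x => rotGen (u x)) = fun x => x 0 * u x 0 + x 1 * u x 1 := by
  funext x
  simp only [swirl, rotGen_apply_zero, rotGen_apply_one]
  ring

/-- `J ∘ u ∈ Cⁿ` for `u ∈ Cⁿ`. [folklore] -/
theorem contDiff_rotGen_comp {n : WithTop ℕ∞} (hu : ContDiff ℝ n u) :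
    ContDiff ℝ n fun x => rotGen (u x) := by
  have h : (fun x => rotGen (u x)) = rotGenL ∘ u := funext fun x => (rotGenL_apply (u x)).symm
  rw [h]
  exact rotGenL.contDiff.comp hu

/-- `D(J ∘ u)(y) h = J (Du(y) h)`. [folklore] -/
theorem fderiv_rotGen_comp_apply {y : EuclideanSpace ℝ (Fin 3)} (hd : DifferentiableAt ℝ u y)
    (h : EuclideanSpace ℝ (Fin 3)) :
    fderiv ℝ (fun x => rotGen (u x)) y h = rotGen (fderiv ℝ u y h) := by
  have hf : HasFDerivAt (fun x => rotGen (u x)) (rotGenL.comp (fderiv ℝ u y)) y := by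
    have := (hasFDerivAt_rotGen (u y)).comp y hd.hasFDerivAt
    simpa [Function.comp_def] using this
  rw [hf.fderiv]
  simp

/-- `(curl (J ∘ u))₂ = ∂₀u₀ + ∂₁u₁` (the horizontal divergence). [folklore] -/
theorem curl_rotGen_comp_apply_two {y : EuclideanSpace ℝ (Fin 3)} (hd : DifferentiableAt ℝ u y) :
    FluidPDE.curl (fun x => rotGen (u x)) y 2 =
      fderiv ℝ u y (EuclideanSpace.single 0 1) 0 + fderiv ℝ u y (EuclideanSpace.single 1 1) 1 := by
  rw [curl_apply_two, fderiv_rotGen_comp_apply hd, fderiv_rotGen_comp_apply hd,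
    rotGen_apply_one, rotGen_apply_zero]
  ring

/-- **`(∂ᵣ(r uʳ))/r = ∂₀u₀ + ∂₁u₁`**: for an axisymmetric `u ∈ C²` the radial derivative quotient
of `x₀u₀ + x₁u₁ = r uʳ` is the horizontal divergence, everywhere on `ℝ³`
(`x₀u₀ + x₁u₁ = swirl (J ∘ u)` and the previous identity for the axisymmetric field `J ∘ u`).
[folklore] -/
theorem IsAxisymmetric.radDerivQuot_horizontal_inner_eq (hax : IsAxisymmetric u)
    (hu : ContDiff ℝ 2 u) :
    radDerivQuot (fun x => x 0 * u x 0 + x 1 * u x 1) = fun y =>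
      fderiv ℝ u y (EuclideanSpace.single 0 1) 0 + fderiv ℝ u y (EuclideanSpace.single 1 1) 1 := by
  have hd : Differentiable ℝ u := hu.differentiable (by norm_num)
  rw [← swirl_rotGen_comp u, hax.rotGen_comp.radDerivQuot_swirl_eq (contDiff_rotGen_comp hu)]
  funext y
  exact curl_rotGen_comp_apply_two (hd y)

/-- For divergence-free axisymmetric `u ∈ C²`: `(∂ᵣ(r uʳ))/r = −∂₂u₂`. [folklore] -/
theorem IsAxisymmetric.radDerivQuot_horizontal_inner_eq_neg (hax : IsAxisymmetric u)
    (hu : ContDiff ℝ 2 u) (hdiv : VectorCalculus.IsDivFree u) :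
    radDerivQuot (fun x => x 0 * u x 0 + x 1 * u x 1) = fun y =>
      -fderiv ℝ u y (EuclideanSpace.single 2 1) 2 := by
  rw [hax.radDerivQuot_horizontal_inner_eq hu]
  funext y
  have h := hdiv y
  rw [divergence_eq_sum_three] at h
  linarith

/-- **`u₁ = u^θ/r` as a ray average of `ω_z`**: `angVelQuot u x = ∫₀¹ s ω_z(s x_h, z) ds`. [folklore] -/
theorem IsAxisymmetric.angVelQuot_eq_integral (hax : IsAxisymmetric u) (hu : ContDiff ℝ 2 u)
    (x : EuclideanSpace ℝ (Fin 3)) :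
    angVelQuot u x = ∫ s in (0 : ℝ)..1, s * FluidPDE.curl u (scaleH s x) 2 := by
  change radQuot (swirl u) x = _
  rw [radQuot, hax.radDerivQuot_swirl_eq hu]

/-- `ω₁ = ω^θ/r` is the angular velocity quotient of the vorticity: `angVortQuot u = angVelQuot (curl u)`.
[folklore] -/
theorem angVortQuot_eq_angVelQuot_curl (u : EuclideanSpace ℝ (Fin 3) → EuclideanSpace ℝ (Fin 3)) :
    angVortQuot u = angVelQuot (FluidPDE.curl u) := rfl

/-- `ρ = uʳ/r` is the angular velocity quotient of `J ∘ u`: `radVelQuot u = angVelQuot (J ∘ u)`.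
[folklore] -/
theorem radVelQuot_eq_angVelQuot_rotGen (u : EuclideanSpace ℝ (Fin 3) → EuclideanSpace ℝ (Fin 3)) :
    radVelQuot u = angVelQuot fun x => rotGen (u x) := by
  change radQuot _ = radQuot _
  rw [swirl_rotGen_comp]

/-- **`ω₁ = ω^θ/r` as a ray average of `(curl ω)_z`**:
`angVortQuot u x = ∫₀¹ s (curl (curl u))_z (s x_h, z) ds`. [folklore] -/
theorem IsAxisymmetric.angVortQuot_eq_integral (hax : IsAxisymmetric u) (hu : ContDiff ℝ 3 u)
    (x : EuclideanSpace ℝ (Fin 3)) :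
    angVortQuot u x =
      ∫ s in (0 : ℝ)..1, s * FluidPDE.curl (FluidPDE.curl u) (scaleH s x) 2 := by
  rw [angVortQuot_eq_angVelQuot_curl]
  exact (hax.curl (hu.differentiable (by norm_num))).angVelQuot_eq_integral
    (contDiff_curl (n := 2) (by exact_mod_cast hu)) x

/-- **`ρ = uʳ/r` as a ray average of `−∂_z u_z`** (divergence-free axisymmetric `u ∈ C²`):
`radVelQuot u x = −∫₀¹ s (∂₂u₂)(s x_h, z) ds`. [folklore] -/
theorem IsAxisymmetric.radVelQuot_eq_integral (hax : IsAxisymmetric u) (hu : ContDiff ℝ 2 u)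
    (hdiv : VectorCalculus.IsDivFree u) (x : EuclideanSpace ℝ (Fin 3)) :
    radVelQuot u x =
      -∫ s in (0 : ℝ)..1, s * fderiv ℝ u (scaleH s x) (EuclideanSpace.single 2 1) 2 := by
  change radQuot _ x = _
  rw [radQuot, hax.radDerivQuot_horizontal_inner_eq_neg hu hdiv, ← intervalIntegral.integral_neg]
  simp only [mul_neg]

end Identities

/-! ### `L²` and sup bounds of `radQuot S` by those of `radDerivQuot S` -/

section RayBounds

variable {S : EuclideanSpace ℝ (Fin 3) → ℝ}

/-- **`∫ ‖Dⁿ(radQuot S)‖² ≤ ∫ ‖Dⁿ(radDerivQuot S)‖²`** for `S ∈ C^∞`: the radial quotient is the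
weighted ray average `x ↦ ∫₀¹ s (radDerivQuot S)(scaleH s x) ds`
(`enorm_iteratedFDeriv_radQuot_le`, `lintegral_sq_rayAverageH_le`). [folklore] -/
theorem lintegral_sq_iteratedFDeriv_radQuot_le_radDerivQuot (hS : ContDiff ℝ ∞ S) (n : ℕ) :
    ∫⁻ x, ‖iteratedFDeriv ℝ n (radQuot S) x‖ₑ ^ 2 ≤
      ∫⁻ y, ‖iteratedFDeriv ℝ n (radDerivQuot S) y‖ₑ ^ 2 := by
  have hS2 : ContDiff ℝ ((⊤ : ℕ∞) + 1 + 1 : ℕ∞) S := by simpa using hS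
  have hq : ContDiff ℝ ∞ (radDerivQuot S) := contDiff_radDerivQuot (n := (⊤ : ℕ∞)) hS2
  have hm : Measurable fun y => ‖iteratedFDeriv ℝ n (radDerivQuot S) y‖ₑ :=
    (hq.continuous_iteratedFDeriv (m := n)
      (by exact_mod_cast (le_top : (n : ℕ∞) ≤ ⊤))).enorm.measurable
  calc ∫⁻ x, ‖iteratedFDeriv ℝ n (radQuot S) x‖ₑ ^ 2
      ≤ ∫⁻ x, (∫⁻ s in Ioo (0 : ℝ) 1,
          ENNReal.ofReal s * ‖iteratedFDeriv ℝ n (radDerivQuot S) (scaleH s x)‖ₑ) ^ 2 :=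
        lintegral_mono fun x => by
          gcongr
          exact enorm_iteratedFDeriv_radQuot_le hS n x
    _ ≤ ∫⁻ y, ‖iteratedFDeriv ℝ n (radDerivQuot S) y‖ₑ ^ 2 := lintegral_sq_rayAverageH_le hm

/-- **`‖Dⁿ(radQuot S)‖ ≤ B/2` if `‖Dⁿ(radDerivQuot S)‖ ≤ B`** (`S ∈ C^∞`; `∫₀¹ s ds = 1/2`). [folklore] -/
theorem norm_iteratedFDeriv_radQuot_le_half (hS : ContDiff ℝ ∞ S) (n : ℕ) {B : ℝ}
    (hB : ∀ y, ‖iteratedFDeriv ℝ n (radDerivQuot S) y‖ ≤ B) (x : EuclideanSpace ℝ (Fin 3)) :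
    ‖iteratedFDeriv ℝ n (radQuot S) x‖ ≤ B / 2 := by
  have hS2 : ContDiff ℝ ((⊤ : ℕ∞) + 1 + 1 : ℕ∞) S := by simpa using hS
  have hqc : ContDiff ℝ ∞ (radDerivQuot S) := contDiff_radDerivQuot (n := (⊤ : ℕ∞)) hS2
  have hcq : Continuous fun s : ℝ => s * ‖iteratedFDeriv ℝ n (radDerivQuot S) (scaleH s x)‖ :=
    continuous_id.mul ((hqc.continuous_iteratedFDeriv (m := n)
      (by exact_mod_cast (le_top : (n : ℕ∞) ≤ ⊤))).comp ((contDiff_scaleH_uncurry (n := 0)).continuous.comp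
        (continuous_const.prodMk continuous_id))).norm
  refine (norm_iteratedFDeriv_radQuot_le hS n x).trans ?_
  have h := intervalIntegral.integral_mono_on (μ := volume) (g := fun s => s * B) zero_le_one
    (hcq.intervalIntegrable 0 1) ((continuous_id.mul continuous_const).intervalIntegrable 0 1)
    (fun s hs => mul_le_mul_of_nonneg_left (hB (scaleH s x)) hs.1)
  rw [intervalIntegral.integral_mul_const, integral_id] at h
  refine h.trans (le_of_eq ?_)
  ring

end RayBounds

/-! ### Sobolev and sup bounds of `u₁`, `ρ`, `ω₁` by those of `u` -/

section QuotientBounds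

variable {u : EuclideanSpace ℝ (Fin 3) → EuclideanSpace ℝ (Fin 3)}

/-- A coordinate of a field has smaller iterated derivatives: `‖Dⁿ(v ·)ᵢ‖ ≤ ‖Dⁿv‖`. [folklore] -/
theorem norm_iteratedFDeriv_apply_coord_le {v : EuclideanSpace ℝ (Fin 3) → EuclideanSpace ℝ (Fin 3)}
    {N : WithTop ℕ∞} {n : ℕ} (hv : ContDiff ℝ N v) (hn : (n : WithTop ℕ∞) ≤ N) (i : Fin 3)
    (x : EuclideanSpace ℝ (Fin 3)) :
    ‖iteratedFDeriv ℝ n (fun y => v y i) x‖ ≤ ‖iteratedFDeriv ℝ n v x‖ := by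
  have h : (fun y => v y i) = (EuclideanSpace.proj i : EuclideanSpace ℝ (Fin 3) →L[ℝ] ℝ) ∘ v := rfl
  rw [h]
  refine (ContinuousLinearMap.norm_iteratedFDeriv_comp_left _ hv.contDiffAt hn).trans ?_
  have hP : ‖(EuclideanSpace.proj i : EuclideanSpace ℝ (Fin 3) →L[ℝ] ℝ)‖ ≤ 1 :=
    ContinuousLinearMap.opNorm_le_bound _ zero_le_one fun y => by
      simpa using PiLp.norm_apply_le y i
  calc _ ≤ 1 * ‖iteratedFDeriv ℝ n v x‖ := mul_le_mul_of_nonneg_right hP (norm_nonneg _)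
    _ = _ := one_mul _

/-- `‖Dⁿ ω_z‖ ≤ ‖curlCLM‖ ‖Dⁿ⁺¹u‖`. [folklore] -/
theorem norm_iteratedFDeriv_curl_apply_two_le {n : ℕ} (hu : ContDiff ℝ (n + 1) u)
    (x : EuclideanSpace ℝ (Fin 3)) :
    ‖iteratedFDeriv ℝ n (fun y => FluidPDE.curl u y 2) x‖ ≤
      ‖(curlCLM : (EuclideanSpace ℝ (Fin 3) →L[ℝ] EuclideanSpace ℝ (Fin 3)) →L[ℝ]
        EuclideanSpace ℝ (Fin 3))‖ * ‖iteratedFDeriv ℝ (n + 1) u x‖ := by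
  have hc : ContDiff ℝ n (FluidPDE.curl u) := by
    have := contDiff_curl (n := (n : ℕ∞)) (by exact_mod_cast hu)
    exact_mod_cast this
  exact (norm_iteratedFDeriv_apply_coord_le hc le_rfl 2 x).trans (norm_iteratedFDeriv_curl_le hu x)

/-- `‖J‖ ≤ 1` for the rotation generator as a linear map of `ℝ³`. [folklore] -/
theorem norm_rotGenL_le_one :
    ‖(rotGenL : EuclideanSpace ℝ (Fin 3) →L[ℝ] EuclideanSpace ℝ (Fin 3))‖ ≤ 1 := by
  refine ContinuousLinearMap.opNorm_le_bound _ zero_le_one fun v => ?_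
  rw [one_mul, rotGenL_apply, EuclideanSpace.norm_eq, EuclideanSpace.norm_eq]
  refine Real.sqrt_le_sqrt ?_
  simp only [Fin.sum_univ_three, Real.norm_eq_abs, sq_abs, rotGen_apply_zero, rotGen_apply_one,
    rotGen_apply_two]
  nlinarith [sq_nonneg (v 2)]

/-- `‖Dⁿ(J ∘ u)‖ ≤ ‖Dⁿu‖`. [folklore] -/
theorem norm_iteratedFDeriv_rotGen_comp_le {N : WithTop ℕ∞} {n : ℕ} (hu : ContDiff ℝ N u)
    (hn : (n : WithTop ℕ∞) ≤ N) (x : EuclideanSpace ℝ (Fin 3)) :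
    ‖iteratedFDeriv ℝ n (fun y => rotGen (u y)) x‖ ≤ ‖iteratedFDeriv ℝ n u x‖ := by
  have h : (fun y => rotGen (u y)) = rotGenL ∘ u := funext fun y => (rotGenL_apply (u y)).symm
  rw [h]
  refine (ContinuousLinearMap.norm_iteratedFDeriv_comp_left _ hu.contDiffAt hn).trans ?_
  calc _ ≤ 1 * ‖iteratedFDeriv ℝ n u x‖ :=
        mul_le_mul_of_nonneg_right norm_rotGenL_le_one (norm_nonneg _)
    _ = _ := one_mul _

/-- **`∫ ‖Dⁿu₁‖² ≤ ‖curlCLM‖² ∫ ‖Dⁿ⁺¹u‖²`** for an axisymmetric `u ∈ C^∞`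
(`u₁ = angVelQuot u = u^θ/r`). [folklore] -/
theorem IsAxisymmetric.lintegral_sq_iteratedFDeriv_angVelQuot_le (hax : IsAxisymmetric u)
    (hu : ContDiff ℝ ∞ u) (n : ℕ) :
    ∫⁻ x, ‖iteratedFDeriv ℝ n (angVelQuot u) x‖ₑ ^ 2 ≤
      ENNReal.ofReal (‖(curlCLM : (EuclideanSpace ℝ (Fin 3) →L[ℝ] EuclideanSpace ℝ (Fin 3)) →L[ℝ]
        EuclideanSpace ℝ (Fin 3))‖ ^ 2) * ∫⁻ x, ‖iteratedFDeriv ℝ (n + 1) u x‖ₑ ^ 2 := by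
  have hS : ContDiff ℝ ∞ (swirl u) := contDiff_swirl hu
  have h2 : ContDiff ℝ 2 u := contDiff_infty.1 hu 2
  have hn1 : ContDiff ℝ (n + 1) u := hu.of_le (by exact_mod_cast le_top)
  have hc0 : (0 : ℝ) ≤ ‖(curlCLM : (EuclideanSpace ℝ (Fin 3) →L[ℝ] EuclideanSpace ℝ (Fin 3)) →L[ℝ]
      EuclideanSpace ℝ (Fin 3))‖ := by positivity
  set c : ℝ := ‖(curlCLM : (EuclideanSpace ℝ (Fin 3) →L[ℝ] EuclideanSpace ℝ (Fin 3)) →L[ℝ]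
      EuclideanSpace ℝ (Fin 3))‖ with hcdef
  calc ∫⁻ x, ‖iteratedFDeriv ℝ n (angVelQuot u) x‖ₑ ^ 2
      ≤ ∫⁻ y, ‖iteratedFDeriv ℝ n (radDerivQuot (swirl u)) y‖ₑ ^ 2 :=
        lintegral_sq_iteratedFDeriv_radQuot_le_radDerivQuot hS n
    _ ≤ ∫⁻ y, (ENNReal.ofReal c * ‖iteratedFDeriv ℝ (n + 1) u y‖ₑ) ^ 2 := by
        refine lintegral_mono fun y => ?_
        rw [hax.radDerivQuot_swirl_eq h2]
        gcongr
        rw [← ofReal_norm, ← ofReal_norm]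
        calc ENNReal.ofReal ‖iteratedFDeriv ℝ n (fun y => FluidPDE.curl u y 2) y‖
            ≤ ENNReal.ofReal (c * ‖iteratedFDeriv ℝ (n + 1) u y‖) :=
              ENNReal.ofReal_le_ofReal (norm_iteratedFDeriv_curl_apply_two_le hn1 y)
          _ = _ := ENNReal.ofReal_mul hc0
    _ = _ := by
        rw [← lintegral_const_mul' _ _ ENNReal.ofReal_ne_top]
        refine lintegral_congr fun y => ?_
        rw [mul_pow, ENNReal.ofReal_pow hc0]

/-- **`‖Dⁿu₁‖ ≤ ‖curlCLM‖ B / 2` if `‖Dⁿ⁺¹u‖ ≤ B`**, for an axisymmetric `u ∈ C^∞`. [folklore] -/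
theorem IsAxisymmetric.norm_iteratedFDeriv_angVelQuot_le (hax : IsAxisymmetric u)
    (hu : ContDiff ℝ ∞ u) (n : ℕ) {B : ℝ} (hB : ∀ y, ‖iteratedFDeriv ℝ (n + 1) u y‖ ≤ B)
    (x : EuclideanSpace ℝ (Fin 3)) :
    ‖iteratedFDeriv ℝ n (angVelQuot u) x‖ ≤
      ‖(curlCLM : (EuclideanSpace ℝ (Fin 3) →L[ℝ] EuclideanSpace ℝ (Fin 3)) →L[ℝ]
        EuclideanSpace ℝ (Fin 3))‖ * B / 2 := by
  have hS : ContDiff ℝ ∞ (swirl u) := contDiff_swirl hu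
  have h2 : ContDiff ℝ 2 u := contDiff_infty.1 hu 2
  have hn1 : ContDiff ℝ (n + 1) u := hu.of_le (by exact_mod_cast le_top)
  refine norm_iteratedFDeriv_radQuot_le_half hS n (fun y => ?_) x
  rw [hax.radDerivQuot_swirl_eq h2]
  exact (norm_iteratedFDeriv_curl_apply_two_le hn1 y).trans
    (mul_le_mul_of_nonneg_left (hB y) (by positivity))

/-- **`∫ ‖Dⁿρ‖² ≤ ‖curlCLM‖² ∫ ‖Dⁿ⁺¹u‖²`** for an axisymmetric `u ∈ C^∞`
(`ρ = radVelQuot u = uʳ/r = angVelQuot (J ∘ u)`, `‖Dᵏ(J ∘ u)‖ ≤ ‖Dᵏu‖`). [folklore] -/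
theorem IsAxisymmetric.lintegral_sq_iteratedFDeriv_radVelQuot_le (hax : IsAxisymmetric u)
    (hu : ContDiff ℝ ∞ u) (n : ℕ) :
    ∫⁻ x, ‖iteratedFDeriv ℝ n (radVelQuot u) x‖ₑ ^ 2 ≤
      ENNReal.ofReal (‖(curlCLM : (EuclideanSpace ℝ (Fin 3) →L[ℝ] EuclideanSpace ℝ (Fin 3)) →L[ℝ]
        EuclideanSpace ℝ (Fin 3))‖ ^ 2) * ∫⁻ x, ‖iteratedFDeriv ℝ (n + 1) u x‖ₑ ^ 2 := by
  rw [radVelQuot_eq_angVelQuot_rotGen]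
  refine (hax.rotGen_comp.lintegral_sq_iteratedFDeriv_angVelQuot_le
    (contDiff_rotGen_comp hu) n).trans (mul_le_mul' le_rfl (lintegral_mono fun y => ?_))
  gcongr
  rw [← ofReal_norm, ← ofReal_norm]
  exact ENNReal.ofReal_le_ofReal
    (norm_iteratedFDeriv_rotGen_comp_le hu (by exact_mod_cast le_top) y)

/-- **`‖Dⁿρ‖ ≤ ‖curlCLM‖ B / 2` if `‖Dⁿ⁺¹u‖ ≤ B`**, for an axisymmetric `u ∈ C^∞`. [folklore] -/
theorem IsAxisymmetric.norm_iteratedFDeriv_radVelQuot_le (hax : IsAxisymmetric u)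
    (hu : ContDiff ℝ ∞ u) (n : ℕ) {B : ℝ} (hB : ∀ y, ‖iteratedFDeriv ℝ (n + 1) u y‖ ≤ B)
    (x : EuclideanSpace ℝ (Fin 3)) :
    ‖iteratedFDeriv ℝ n (radVelQuot u) x‖ ≤
      ‖(curlCLM : (EuclideanSpace ℝ (Fin 3) →L[ℝ] EuclideanSpace ℝ (Fin 3)) →L[ℝ]
        EuclideanSpace ℝ (Fin 3))‖ * B / 2 := by
  rw [radVelQuot_eq_angVelQuot_rotGen]
  exact hax.rotGen_comp.norm_iteratedFDeriv_angVelQuot_le (contDiff_rotGen_comp hu) n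
    (fun y => (norm_iteratedFDeriv_rotGen_comp_le hu (by exact_mod_cast le_top) y).trans (hB y)) x

/-- **`∫ ‖Dⁿω₁‖² ≤ ‖curlCLM‖⁴ ∫ ‖Dⁿ⁺²u‖²`** for an axisymmetric `u ∈ C^∞`
(`ω₁ = angVortQuot u = ω^θ/r = angVelQuot (curl u)`). [folklore] -/
theorem IsAxisymmetric.lintegral_sq_iteratedFDeriv_angVortQuot_le (hax : IsAxisymmetric u)
    (hu : ContDiff ℝ ∞ u) (n : ℕ) :
    ∫⁻ x, ‖iteratedFDeriv ℝ n (angVortQuot u) x‖ₑ ^ 2 ≤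
      ENNReal.ofReal (‖(curlCLM : (EuclideanSpace ℝ (Fin 3) →L[ℝ] EuclideanSpace ℝ (Fin 3)) →L[ℝ]
        EuclideanSpace ℝ (Fin 3))‖ ^ 4) * ∫⁻ x, ‖iteratedFDeriv ℝ (n + 2) u x‖ₑ ^ 2 := by
  have hc : ContDiff ℝ ∞ (FluidPDE.curl u) := contDiff_curl (n := (⊤ : ℕ∞)) (by simpa using hu)
  have hn2 : ContDiff ℝ (n + 1 + 1) u := hu.of_le (by exact_mod_cast le_top)
  have hc0 : (0 : ℝ) ≤ ‖(curlCLM : (EuclideanSpace ℝ (Fin 3) →L[ℝ] EuclideanSpace ℝ (Fin 3)) →L[ℝ]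
      EuclideanSpace ℝ (Fin 3))‖ := by positivity
  set c : ℝ := ‖(curlCLM : (EuclideanSpace ℝ (Fin 3) →L[ℝ] EuclideanSpace ℝ (Fin 3)) →L[ℝ]
      EuclideanSpace ℝ (Fin 3))‖ with hcdef
  rw [angVortQuot_eq_angVelQuot_curl]
  refine ((hax.curl (hu.differentiable (by simp))).lintegral_sq_iteratedFDeriv_angVelQuot_le
    hc n).trans ?_
  calc ENNReal.ofReal (c ^ 2) * ∫⁻ y, ‖iteratedFDeriv ℝ (n + 1) (FluidPDE.curl u) y‖ₑ ^ 2
      ≤ ENNReal.ofReal (c ^ 2) *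
          ∫⁻ y, (ENNReal.ofReal c * ‖iteratedFDeriv ℝ (n + 2) u y‖ₑ) ^ 2 := by
        refine mul_le_mul' le_rfl (lintegral_mono fun y => ?_)
        gcongr
        rw [← ofReal_norm, ← ofReal_norm]
        calc ENNReal.ofReal ‖iteratedFDeriv ℝ (n + 1) (FluidPDE.curl u) y‖
            ≤ ENNReal.ofReal (c * ‖iteratedFDeriv ℝ (n + 1 + 1) u y‖) :=
              ENNReal.ofReal_le_ofReal (norm_iteratedFDeriv_curl_le hn2 y)
          _ = ENNReal.ofReal c * ENNReal.ofReal ‖iteratedFDeriv ℝ (n + 2) u y‖ :=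
              ENNReal.ofReal_mul hc0
    _ = ENNReal.ofReal (c ^ 4) * ∫⁻ x, ‖iteratedFDeriv ℝ (n + 2) u x‖ₑ ^ 2 := by
        have h1 : ∫⁻ y, (ENNReal.ofReal c * ‖iteratedFDeriv ℝ (n + 2) u y‖ₑ) ^ 2 =
            ENNReal.ofReal (c ^ 2) * ∫⁻ y, ‖iteratedFDeriv ℝ (n + 2) u y‖ₑ ^ 2 := by
          rw [← lintegral_const_mul' _ _ ENNReal.ofReal_ne_top]
          exact lintegral_congr fun y => by rw [mul_pow, ENNReal.ofReal_pow hc0]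
        rw [h1, ← mul_assoc, ← ENNReal.ofReal_mul (sq_nonneg _),
          show c ^ 2 * c ^ 2 = c ^ 4 by ring]

/-- **`‖Dⁿω₁‖ ≤ ‖curlCLM‖² B / 2` if `‖Dⁿ⁺²u‖ ≤ B`**, for an axisymmetric `u ∈ C^∞`. [folklore] -/
theorem IsAxisymmetric.norm_iteratedFDeriv_angVortQuot_le (hax : IsAxisymmetric u)
    (hu : ContDiff ℝ ∞ u) (n : ℕ) {B : ℝ} (hB : ∀ y, ‖iteratedFDeriv ℝ (n + 2) u y‖ ≤ B)
    (x : EuclideanSpace ℝ (Fin 3)) :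
    ‖iteratedFDeriv ℝ n (angVortQuot u) x‖ ≤
      ‖(curlCLM : (EuclideanSpace ℝ (Fin 3) →L[ℝ] EuclideanSpace ℝ (Fin 3)) →L[ℝ]
        EuclideanSpace ℝ (Fin 3))‖ ^ 2 * B / 2 := by
  have hc : ContDiff ℝ ∞ (FluidPDE.curl u) := contDiff_curl (n := (⊤ : ℕ∞)) (by simpa using hu)
  have hn2 : ContDiff ℝ (n + 1 + 1) u := hu.of_le (by exact_mod_cast le_top)
  rw [angVortQuot_eq_angVelQuot_curl, sq, mul_assoc]
  refine (hax.curl (hu.differentiable (by simp))).norm_iteratedFDeriv_angVelQuot_le hc n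
    (fun y => ?_) x
  exact (norm_iteratedFDeriv_curl_le hn2 y).trans (mul_le_mul_of_nonneg_left (hB y) (by positivity))

end QuotientBounds

/-! ### Family forms: bounded Sobolev norms and bounded derivatives on a slab -/

section Family

variable {S : Set ℝ}
  {u : ℝ → EuclideanSpace ℝ (Fin 3) → EuclideanSpace ℝ (Fin 3)}

/-- **Sobolev imbedding for all derivatives of a time family**: if every slice `g t`, `t ∈ S`,
is `C^∞` with `L²` Sobolev norms of every order bounded uniformly in `t`, then every `Dⁿ(g t)` is
bounded on `S × ℝ³` (`H²(ℝ³) ⊂ C_B` applied to `Dⁿ(g t)`, whose Sobolev norms are those of `g t`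
shifted by `n`). [cite: AdamsFournier2003, Thm. 4.12 Part I Case A (mp > n)] -/
theorem exists_forall_norm_iteratedFDeriv_le_of_sobolev {F : Type} [NormedAddCommGroup F]
    [NormedSpace ℝ F] [FiniteDimensional ℝ F] {g : ℝ → EuclideanSpace ℝ (Fin 3) → F}
    (hg : ∀ t ∈ S, ContDiff ℝ ∞ (g t))
    (hH : ∀ n : ℕ, ∃ C : ℝ≥0, ∀ t ∈ S, ∫⁻ x, ‖iteratedFDeriv ℝ n (g t) x‖ₑ ^ 2 ≤ C) (n : ℕ) :
    ∃ B : ℝ, 0 ≤ B ∧ ∀ t ∈ S, ∀ x, ‖iteratedFDeriv ℝ n (g t) x‖ ≤ B := by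
  haveI : FiniteDimensional ℝ (EuclideanSpace ℝ (Fin 3) [×n]→L[ℝ] F) :=
    FiniteDimensional.of_injective
      (ContinuousMultilinearMap.toMultilinearMapLinear :
        (EuclideanSpace ℝ (Fin 3) [×n]→L[ℝ] F) →ₗ[ℝ]
          MultilinearMap ℝ (fun _ : Fin n => EuclideanSpace ℝ (Fin 3)) F)
      ContinuousMultilinearMap.toMultilinearMap_injective
  refine exists_forall_norm_le_of_sobolev_bounds (g := fun t => iteratedFDeriv ℝ n (g t))
    (fun t ht => ?_) fun j _ => ?_
  · have h := contDiff_infty.1 (hg t ht) (2 + n)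
    exact h.iteratedFDeriv_right (m := 2) (i := n) (by push_cast; exact le_rfl)
  · obtain ⟨C, hC⟩ := hH (n + j)
    refine ⟨C, fun t ht => le_of_eq_of_le (lintegral_congr fun x => ?_) (hC t ht)⟩
    rw [← ofReal_norm, norm_iteratedFDeriv_iteratedFDeriv, ofReal_norm]

/-- In a family with bounded Sobolev norms all derivatives of the field are bounded on the slab.
[cite: AdamsFournier2003, Thm. 4.12 Part I Case A (mp > n)] -/
theorem HasBoundedSobolevNormsOn.exists_forall_norm_iteratedFDeriv_le
    (hH : HasBoundedSobolevNormsOn S u) (hsm : ∀ t ∈ S, ContDiff ℝ ∞ (u t)) (n : ℕ) :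
    ∃ B : ℝ, 0 ≤ B ∧ ∀ t ∈ S, ∀ x, ‖iteratedFDeriv ℝ n (u t) x‖ ≤ B :=
  exists_forall_norm_iteratedFDeriv_le_of_sobolev hsm hH n

/-- **`u₁ = u^θ/r` has bounded Sobolev norms of every order** along an axisymmetric smooth family
with bounded Sobolev norms (e.g. a Tao-class solution). [folklore] -/
theorem exists_lintegral_sq_iteratedFDeriv_angVelQuot_le (hsm : ∀ t ∈ S, ContDiff ℝ ∞ (u t))
    (hax : ∀ t ∈ S, IsAxisymmetric (u t)) (hH : HasBoundedSobolevNormsOn S u) (n : ℕ) :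
    ∃ C : ℝ≥0, ∀ t ∈ S, ∫⁻ x, ‖iteratedFDeriv ℝ n (angVelQuot (u t)) x‖ₑ ^ 2 ≤ C := by
  obtain ⟨C, hC⟩ := hH (n + 1)
  refine ⟨Real.toNNReal (‖(curlCLM : (EuclideanSpace ℝ (Fin 3) →L[ℝ] EuclideanSpace ℝ (Fin 3))
    →L[ℝ] EuclideanSpace ℝ (Fin 3))‖ ^ 2) * C, fun t ht => ?_⟩
  refine ((hax t ht).lintegral_sq_iteratedFDeriv_angVelQuot_le (hsm t ht) n).trans ?_
  rw [ENNReal.coe_mul]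
  exact mul_le_mul' le_rfl (hC t ht)

/-- **`ρ = uʳ/r` has bounded Sobolev norms of every order** along such a family. [folklore] -/
theorem exists_lintegral_sq_iteratedFDeriv_radVelQuot_le (hsm : ∀ t ∈ S, ContDiff ℝ ∞ (u t))
    (hax : ∀ t ∈ S, IsAxisymmetric (u t)) (hH : HasBoundedSobolevNormsOn S u) (n : ℕ) :
    ∃ C : ℝ≥0, ∀ t ∈ S, ∫⁻ x, ‖iteratedFDeriv ℝ n (radVelQuot (u t)) x‖ₑ ^ 2 ≤ C := by
  obtain ⟨C, hC⟩ := hH (n + 1)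
  refine ⟨Real.toNNReal (‖(curlCLM : (EuclideanSpace ℝ (Fin 3) →L[ℝ] EuclideanSpace ℝ (Fin 3))
    →L[ℝ] EuclideanSpace ℝ (Fin 3))‖ ^ 2) * C, fun t ht => ?_⟩
  refine ((hax t ht).lintegral_sq_iteratedFDeriv_radVelQuot_le (hsm t ht) n).trans ?_
  rw [ENNReal.coe_mul]
  exact mul_le_mul' le_rfl (hC t ht)

/-- **`ω₁ = ω^θ/r` has bounded Sobolev norms of every order** along such a family. [folklore] -/
theorem exists_lintegral_sq_iteratedFDeriv_angVortQuot_le (hsm : ∀ t ∈ S, ContDiff ℝ ∞ (u t))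
    (hax : ∀ t ∈ S, IsAxisymmetric (u t)) (hH : HasBoundedSobolevNormsOn S u) (n : ℕ) :
    ∃ C : ℝ≥0, ∀ t ∈ S, ∫⁻ x, ‖iteratedFDeriv ℝ n (angVortQuot (u t)) x‖ₑ ^ 2 ≤ C := by
  obtain ⟨C, hC⟩ := hH (n + 2)
  refine ⟨Real.toNNReal (‖(curlCLM : (EuclideanSpace ℝ (Fin 3) →L[ℝ] EuclideanSpace ℝ (Fin 3))
    →L[ℝ] EuclideanSpace ℝ (Fin 3))‖ ^ 4) * C, fun t ht => ?_⟩
  refine ((hax t ht).lintegral_sq_iteratedFDeriv_angVortQuot_le (hsm t ht) n).trans ?_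
  rw [ENNReal.coe_mul]
  exact mul_le_mul' le_rfl (hC t ht)

/-- The quotient `u₁ (t)` is `C^∞` for a smooth slice. [folklore] -/
theorem contDiff_angVelQuot_of_contDiff {v : EuclideanSpace ℝ (Fin 3) → EuclideanSpace ℝ (Fin 3)}
    (hv : ContDiff ℝ ∞ v) : ContDiff ℝ ∞ (angVelQuot v) := by
  have hS : ContDiff ℝ ((⊤ : ℕ∞) + 1 + 1 : ℕ∞) (swirl v) := by simpa using contDiff_swirl hv
  exact contDiff_radQuot (n := (⊤ : ℕ∞)) hS

/-- The quotient `ρ` is `C^∞` for a smooth slice. [folklore] -/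
theorem contDiff_radVelQuot_of_contDiff {v : EuclideanSpace ℝ (Fin 3) → EuclideanSpace ℝ (Fin 3)}
    (hv : ContDiff ℝ ∞ v) : ContDiff ℝ ∞ (radVelQuot v) := by
  rw [radVelQuot_eq_angVelQuot_rotGen]
  exact contDiff_angVelQuot_of_contDiff (contDiff_rotGen_comp hv)

/-- The quotient `ω₁` is `C^∞` for a smooth slice. [folklore] -/
theorem contDiff_angVortQuot_of_contDiff {v : EuclideanSpace ℝ (Fin 3) → EuclideanSpace ℝ (Fin 3)}
    (hv : ContDiff ℝ ∞ v) : ContDiff ℝ ∞ (angVortQuot v) := by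
  rw [angVortQuot_eq_angVelQuot_curl]
  exact contDiff_angVelQuot_of_contDiff (contDiff_curl (n := (⊤ : ℕ∞)) (by simpa using hv))

/-- **All derivatives of `u₁ = u^θ/r` are bounded on the slab** along an axisymmetric smooth family
with bounded Sobolev norms. [folklore] -/
theorem exists_forall_norm_iteratedFDeriv_angVelQuot_le (hsm : ∀ t ∈ S, ContDiff ℝ ∞ (u t))
    (hax : ∀ t ∈ S, IsAxisymmetric (u t)) (hH : HasBoundedSobolevNormsOn S u) (n : ℕ) :
    ∃ B : ℝ, 0 ≤ B ∧ ∀ t ∈ S, ∀ x, ‖iteratedFDeriv ℝ n (angVelQuot (u t)) x‖ ≤ B :=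
  exists_forall_norm_iteratedFDeriv_le_of_sobolev
    (fun t ht => contDiff_angVelQuot_of_contDiff (hsm t ht))
    (exists_lintegral_sq_iteratedFDeriv_angVelQuot_le hsm hax hH) n

/-- **All derivatives of `ρ = uʳ/r` are bounded on the slab** along such a family. [folklore] -/
theorem exists_forall_norm_iteratedFDeriv_radVelQuot_le (hsm : ∀ t ∈ S, ContDiff ℝ ∞ (u t))
    (hax : ∀ t ∈ S, IsAxisymmetric (u t)) (hH : HasBoundedSobolevNormsOn S u) (n : ℕ) :
    ∃ B : ℝ, 0 ≤ B ∧ ∀ t ∈ S, ∀ x, ‖iteratedFDeriv ℝ n (radVelQuot (u t)) x‖ ≤ B :=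
  exists_forall_norm_iteratedFDeriv_le_of_sobolev
    (fun t ht => contDiff_radVelQuot_of_contDiff (hsm t ht))
    (exists_lintegral_sq_iteratedFDeriv_radVelQuot_le hsm hax hH) n

/-- **All derivatives of `ω₁ = ω^θ/r` are bounded on the slab** along such a family. [folklore] -/
theorem exists_forall_norm_iteratedFDeriv_angVortQuot_le (hsm : ∀ t ∈ S, ContDiff ℝ ∞ (u t))
    (hax : ∀ t ∈ S, IsAxisymmetric (u t)) (hH : HasBoundedSobolevNormsOn S u) (n : ℕ) :
    ∃ B : ℝ, 0 ≤ B ∧ ∀ t ∈ S, ∀ x, ‖iteratedFDeriv ℝ n (angVortQuot (u t)) x‖ ≤ B :=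
  exists_forall_norm_iteratedFDeriv_le_of_sobolev
    (fun t ht => contDiff_angVortQuot_of_contDiff (hsm t ht))
    (exists_lintegral_sq_iteratedFDeriv_angVortQuot_le hsm hax hH) n

end Family

end Literature.Analysis.FluidPDE

end
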